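import Summits.Ventures.PercRepro.S1CoreCapSevenFour
import Summits.Ventures.PercRepro.S1CoreCapSevenThin
import Summits.Ventures.PercRepro.S1CoreCapSixTwoHeavy

/-!
# PercRepro — TOWARDS `Q*(8)`: THE STRUCTURE OF FOUR BIG LINES (p1, gen 27)

At nullity `8`, four lines `L₁, …, L₄` of `≥ 4` points are rigid. Some line meets the union of the other three
in at most two points (`exists_last_le_two`: otherwise all four meet pairwise in distinct points and
`[L₄, L₃, L₂, L₁]` has `lineRank 3` on ten points, against the plane clause — the `ν = 7` argument of
`Seven.not_four_big`). With that line placed last the ordering costs `Σ (|L_i| − 2) + fat (L₁ ∪ … ∪ L₄) ≤ 8`, so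
the four are SIMPLE 4-point lines with no fat point on their union and the ordering costs exactly `8`
(`four_big_simple`). The budget after that prefix is `0`: every other 3-point line is contained in the union
`P₀ = L₄ ∪ (L₃ ∪ (L₂ ∪ L₁))` and carries no fat point (`covered_of_four_big`) — a TRANSVERSAL. (The count of
the transversals — at most four, on a triangle of big lines — is the remaining piece of `FourBigBound₈`.)
`proofs/P1-S4-CAPBRIDGE.md` §19 (B). Axioms: standard.
-/

namespace PercRepro

namespace S1

namespace FourCap

namespace Eight

open Seven

variable {β : Type} [DecidableEq β]

section FourBig

variable {w : β → ℕ} {ls : Finset (Finset β)}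
  (h1 : ∀ L ∈ ls, ∀ v ∈ L, w v = 1 ∨ w v = 2)
  (h2 : ∀ L ∈ ls, 3 ≤ L.card ∧ wsum w L ≤ 5)
  (h3 : ∀ L ∈ ls, ∀ L' ∈ ls, L ≠ L' → (L ∩ L').card ≤ 1)
  (h4 : ∀ l : List (Finset β), l.Nodup → (∀ L ∈ l, L ∈ ls) → wsum w (unionL l) ≤ 8 + lineRank l)
  (h5 : ∀ l : List (Finset β), l.Nodup → (∀ L ∈ l, L ∈ ls) → lineRank l ≤ 3 → (unionL l).card ≤ 9)

include h3 h5 in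
/-- **Some big line meets the union of the other three in at most two points**: four big lines pairwise meeting
in distinct points would give `[L₄, L₃, L₂, L₁]` of `lineRank 3` on ten points. -/
theorem exists_last_le_two {L₁ L₂ L₃ L₄ : Finset β} (hL₁ : L₁ ∈ ls) (hL₂ : L₂ ∈ ls) (hL₃ : L₃ ∈ ls)
    (hL₄ : L₄ ∈ ls) (h12 : L₂ ≠ L₁) (h13 : L₃ ≠ L₁) (h14 : L₄ ≠ L₁) (h23 : L₃ ≠ L₂) (h24 : L₄ ≠ L₂)
    (h34 : L₄ ≠ L₃) (c1 : 4 ≤ L₁.card) (c2 : 4 ≤ L₂.card) (c3 : 4 ≤ L₃.card) (c4 : 4 ≤ L₄.card) :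
    (L₄ ∩ (L₃ ∪ (L₂ ∪ L₁))).card ≤ 2 ∨ (L₃ ∩ (L₄ ∪ (L₂ ∪ L₁))).card ≤ 2 ∨
      (L₂ ∩ (L₄ ∪ (L₃ ∪ L₁))).card ≤ 2 := by
  by_contra hc
  push Not at hc
  obtain ⟨i4, i3, i2⟩ := hc
  -- pairwise intersections
  have p21 := h3 L₂ hL₂ L₁ hL₁ h12
  have p31 := h3 L₃ hL₃ L₁ hL₁ h13
  have p32 := h3 L₃ hL₃ L₂ hL₂ h23
  have p34 := h3 L₃ hL₃ L₄ hL₄ h34.symm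
  have p24 := h3 L₂ hL₂ L₄ hL₄ h24.symm
  have p41 := h3 L₄ hL₄ L₁ hL₁ h14
  have p42 := h3 L₄ hL₄ L₂ hL₂ h24
  have p43 := h3 L₄ hL₄ L₃ hL₃ h34
  -- `L₂` meets `L₁`: from `L₂` last, `3 ≤ |L₂ ∩ L₄| + |L₂ ∩ L₃| + |L₂ ∩ L₁|`
  have j2 : (L₂ ∩ (L₄ ∪ (L₃ ∪ L₁))).card ≤ (L₂ ∩ L₄).card + ((L₂ ∩ L₃).card + (L₂ ∩ L₁).card) :=
    le_trans (card_inter_union_le L₂ L₄ (L₃ ∪ L₁)) (Nat.add_le_add_left (card_inter_union_le L₂ L₃ L₁) _)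
  have p23 := h3 L₂ hL₂ L₃ hL₃ h23.symm
  have e21 : (L₂ ∩ L₁).card = 1 := by omega
  -- `L₃` meets `L₂ ∪ L₁` in two points: from `L₃` last, `3 ≤ |L₃ ∩ L₄| + |L₃ ∩ (L₂ ∪ L₁)|`
  have j3 : (L₃ ∩ (L₄ ∪ (L₂ ∪ L₁))).card ≤ (L₃ ∩ L₄).card + (L₃ ∩ (L₂ ∪ L₁)).card :=
    card_inter_union_le L₃ L₄ (L₂ ∪ L₁)
  have j3' : (L₃ ∩ (L₂ ∪ L₁)).card ≤ (L₃ ∩ L₂).card + (L₃ ∩ L₁).card := card_inter_union_le L₃ L₂ L₁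
  have e3 : (L₃ ∩ (L₂ ∪ L₁)).card = 2 := by omega
  -- `L₄` meets the union of the other three in three points
  have j4 : (L₄ ∩ (L₃ ∪ (L₂ ∪ L₁))).card ≤ (L₄ ∩ L₃).card + ((L₄ ∩ L₂).card + (L₄ ∩ L₁).card) :=
    le_trans (card_inter_union_le L₄ L₃ (L₂ ∪ L₁)) (Nat.add_le_add_left (card_inter_union_le L₄ L₂ L₁) _)
  have e4 : (L₄ ∩ (L₃ ∪ (L₂ ∪ L₁))).card = 3 := by omega
  -- the list `[L₄, L₃, L₂, L₁]`: rank `3`, ten points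
  have s2 := Finset.card_sdiff_add_card_inter L₂ L₁
  have s3 := Finset.card_sdiff_add_card_inter L₃ (L₂ ∪ L₁)
  have s4 := Finset.card_sdiff_add_card_inter L₄ (L₃ ∪ (L₂ ∪ L₁))
  have u2 := Finset.card_union_add_card_inter L₂ L₁
  have u3 := Finset.card_union_add_card_inter L₃ (L₂ ∪ L₁)
  have u4 := Finset.card_union_add_card_inter L₄ (L₃ ∪ (L₂ ∪ L₁))
  have hr := h5 [L₄, L₃, L₂, L₁] (by simp [h12, h13, h14, h23, h24, h34]) (by simp [hL₁, hL₂, hL₃, hL₄])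
  simp only [lineRank, unionL, Finset.union_empty, Finset.sdiff_empty, Finset.inter_empty, Finset.card_empty,
    Nat.zero_add] at hr
  omega

include h1 h2 h3 h4 in
/-- **Four big lines are four simple 4-point lines with no fat point, at cost exactly `8`**, once the last one
meets the union of the other three in at most two points. -/
theorem four_big_simple {L₁ L₂ L₃ L₄ : Finset β} (hL₁ : L₁ ∈ ls) (hL₂ : L₂ ∈ ls) (hL₃ : L₃ ∈ ls)
    (hL₄ : L₄ ∈ ls) (h12 : L₂ ≠ L₁) (h13 : L₃ ≠ L₁) (h14 : L₄ ≠ L₁) (h23 : L₃ ≠ L₂) (h24 : L₄ ≠ L₂)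
    (h34 : L₄ ≠ L₃) (c1 : 4 ≤ L₁.card) (c2 : 4 ≤ L₂.card) (c3 : 4 ≤ L₃.card) (c4 : 4 ≤ L₄.card)
    (hlast : (L₄ ∩ (L₃ ∪ (L₂ ∪ L₁))).card ≤ 2) :
    L₁.card = 4 ∧ L₂.card = 4 ∧ L₃.card = 4 ∧ L₄.card = 4 ∧ fat w (L₄ ∪ (L₃ ∪ (L₂ ∪ L₁))) = 0 ∧
      costSum w [L₄, L₃, L₂, L₁] = 8 := by
  have hc := costSum_le h1 (two_le_card_of_spec h2) h4 [L₄, L₃, L₂, L₁]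
    (by simp [h12, h13, h14, h23, h24, h34]) (by simp [hL₁, hL₂, hL₃, hL₄])
  have e1 := lineCost_empty w L₁
  have e2 := lineCost_of_inter_le_two (w := w) (le_trans (h3 L₂ hL₂ L₁ hL₁ h12) (by omega))
  have e3 := lineCost_of_inter_le_two (w := w) (le_trans (card_inter_union_le L₃ L₂ L₁)
    (by have := h3 L₃ hL₃ L₂ hL₂ h23; have := h3 L₃ hL₃ L₁ hL₁ h13; omega))
  have e4 := lineCost_of_inter_le_two (w := w) hlast
  have f2 := fat_union_eq w L₂ L₁
  have f3 := fat_union_eq w L₃ (L₂ ∪ L₁)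
  have f4 := fat_union_eq w L₄ (L₃ ∪ (L₂ ∪ L₁))
  simp only [costSum, unionL, Finset.union_empty, Nat.zero_add] at hc ⊢
  omega

include h1 h2 h4 in
/-- **Every other line is a transversal**: with the four big lines at cost `8`, a further 3-point line of the
configuration lies inside their union and has no fat point. -/
theorem covered_of_four_big {L₁ L₂ L₃ L₄ : Finset β} (hL₁ : L₁ ∈ ls) (hL₂ : L₂ ∈ ls) (hL₃ : L₃ ∈ ls)
    (hL₄ : L₄ ∈ ls) (h12 : L₂ ≠ L₁) (h13 : L₃ ≠ L₁) (h14 : L₄ ≠ L₁) (h23 : L₃ ≠ L₂) (h24 : L₄ ≠ L₂)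
    (h34 : L₄ ≠ L₃) (hcost : costSum w [L₄, L₃, L₂, L₁] = 8) (hfat : fat w (L₄ ∪ (L₃ ∪ (L₂ ∪ L₁))) = 0)
    {L : Finset β} (hL : L ∈ ls) (hL1 : L ≠ L₁) (hL2 : L ≠ L₂) (hL3 : L ≠ L₃) (hL4 : L ≠ L₄)
    (hL3c : L.card = 3) : L ⊆ L₄ ∪ (L₃ ∪ (L₂ ∪ L₁)) ∧ fat w L = 0 := by
  have hb := budget_of_prefix h1 (two_le_card_of_spec h2) h4 [L₄, L₃, L₂, L₁] [L]
    (by simp [h12, h13, h14, h23, h24, h34, hL1, hL2, hL3, hL4]) (by simp [hL, hL₁, hL₂, hL₃, hL₄])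
    (by simpa using hL3c)
  simp only [unionL, Finset.union_empty] at hb
  rw [hcost, hfat] at hb
  simp only [freeCountR, unionLR, Nat.zero_add] at hb
  have hsub : L ⊆ L₄ ∪ (L₃ ∪ (L₂ ∪ L₁)) := by
    by_contra hns
    rw [if_neg hns] at hb
    omega
  refine ⟨hsub, ?_⟩
  rw [if_pos hsub] at hb
  have := fat_mono w (Finset.subset_union_left (s₁ := L) (s₂ := L₄ ∪ (L₃ ∪ (L₂ ∪ L₁))))
  omega

end FourBig

end Eight

end FourCap

end S1

end PercRepro
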